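import Summits.MatrixMultiplication.OmegaCensus.ThreeSetZ5Z5Cover33
import Summits.MatrixMultiplication.OmegaCensus.ThreeSetZ5Z5Cover34
import Summits.MatrixMultiplication.OmegaCensus.ThreeSetZ5Z5Cells36
import HarnessLib

/-!
# No cube law triple with parts `(3,3,·)` or `(3,4,·)` over `ℤ₅ × ℤ₆₅`: the census cells `(3,3,12)@325` and `(3,4,9)@325`

ω-census `pub-omega`, family (b3), seat pub-omega-group gen 37.  Framing: lottery ticket; floor = certified bounds/negative
ranges.  VALUE: a kernel theorem about the group-theoretic method (TPP capacity of dihedral-like groups): the last two ENGINE-only cells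
with a part of size `3` of the law census `≤ 1000` (`ℤ₅ × ℤ₆₅`, NR79: `(3,3,12)`, `(3,4,9)`, hitherto ENGINE ×2/×3) are KERNEL; with
`ThreeSetZ5Z5Cells36` (`(3,6,6)`) and the domino cells, only `(1,9,12)@325` of order `325` stays engine-only.  NOT progress on ω.

Why a JOINT argument (gen 36, RESULTS-g36 §3): the `ℤ₅²` data of these two shapes have genuine local solutions at `|A| = 325`
(`W̄`, `X̄` triangles with the common centroid `Φ(x₀) = (2,2)`, unique fibre counts of `Y`), and the `ℤ₁₃` line identity alone has
thousands of solutions.  The proof reads BOTH projections at once: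
1. (`ℤ₅²` stage, `ThreeSetZ5Z5Cover33/34.lean`) normalise `Φ'(W − w₀) = T = {0, e₁, e₂}` (`basisEquiv`; the degenerate case is a coset
   obstruction); every image multiset of `X` and hole either carries a modular three-set LINE certificate (`lineCert3At_sound`), or is an
   explicit exception refuted by a plane ROW certificate at fibre size `13` (`false_of_refuteRowOK`), or is one of the six rigid
   configurations, for which `25` row certificates PIN the fibre counts of `Y` (`eq_of_pinRowsOK`);
2. (`ℤ₁₃` stage, `ThreeSetFibreMoment.lean`, `ThreeSetZ5Z13MomentCertificate.lean`) for a second projection `Ψ : A →+ ZMod 13` whose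
   `Φ`-fibre sums vanish, the FIRST MOMENTS of `Ψ` along the `25` fibres are linear over `𝔽₁₃` in the `Ψ`-fibre-sums of `W, X, Y` and
   `Ψ(x₀)`; two explicit test vectors isolate `Ψ(u)` and `Ψ(v)` (`W − w₀ = {0, u, v}`) and force `Ψ(u) = Ψ(v) = 0`, i.e. `W − w₀ ⊆ ker Ψ`,
   a proper subgroup — contradicting `|W| = 3` (`card_eq_one_of_subset_coset`).
* **`no_cube_form_3x_of_card325`** (core, `d ∈ {3,4}` through the finite statements `fin33` / `fin34`), **`no_cube_form_33_of_card325`**,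
  **`no_cube_form_34_of_card325`**; TPP statements `no_law_cube_33e_z5z13`, `no_law_cube_34e_z5z13`, the all-orderings cell forms, and
  the census instances **`no_law_cube_three_three_z5_z65`**, **`no_law_cube_three_four_z5_z65`** (`A = ℤ₅ × ℤ₆₅`, any `c₀`).
Hypotheses on `A` (all satisfied by `ℤ₅ × ℤ₆₅`, the only abelian group of order `325` with a `ℤ₅²` quotient): `|A| = 325`,
`Φ : A ↠ ℤ₅²`, `Ψ : A →+ ZMod 13` non-zero with `Σ_{a ∈ Φ⁻¹(t)} Ψ a = 0` for every `t`.
-/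

namespace Summit.MatrixMultiplication.OmegaCensus

open Finset ZpZpDomino Z5Z5ThreeSet FibreMoment

section Core

variable {A : Type*} [AddCommGroup A] [Fintype A] [DecidableEq A]

/-- All fibres of a surjection onto `ZMod 5 × ZMod 5` have size `|A| / 25`. [folklore] -/
theorem twentyfive_mul_card_fibre (φ : A →+ ZMod 5 × ZMod 5) (hφ : Function.Surjective φ) :
    25 * (univ.filter fun a : A => φ a = 0).card = Fintype.card A := by
  classical
  rw [← Finset.card_univ (α := A), Finset.card_eq_sum_card_fiberwise (f := fun a : A => φ a) (s := univ) (t := univ)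
    (fun a _ => mem_coe.2 (mem_univ _))]
  rw [Finset.sum_congr rfl fun t _ => card_fibre_eq_of_surjective φ hφ t 0, sum_const, card_univ, Fintype.card_prod, ZMod.card,
    smul_eq_mul]

/-- The indicator of `T` on `ℤ₅²` in point numbering: `𝟙[v = 0] + 𝟙[v = e₁] + 𝟙[v = e₂] = tlist[ptIdx v]`. [folklore] -/
theorem Z5Z5ThreeSet.ite_T_eq_gridFn_tlist (v : ZMod 5 × ZMod 5) :
    (if (0 : ZMod 5 × ZMod 5) = v then 1 else 0) + ((if ((1, 0) : ZMod 5 × ZMod 5) = v then 1 else 0) +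
      (if ((0, 1) : ZMod 5 × ZMod 5) = v then 1 else 0)) = gridFn tlist v := by
  revert v; decide

/-- The centroid point: `pt 5 12 = (2, 2)`. [folklore] -/
theorem Z5Z5ThreeSet.pt_twelve : pt 5 12 = ((2, 2) : ZMod 5 × ZMod 5) := by decide

/-- Values of the indicator of `T` at its three points. [folklore] -/
theorem Z5Z5ThreeSet.gridFn_tlist_vals :
    gridFn tlist ((0, 0) : ZMod 5 × ZMod 5) = 1 ∧ gridFn tlist ((1, 0) : ZMod 5 × ZMod 5) = 1 ∧
      gridFn tlist ((0, 1) : ZMod 5 × ZMod 5) = 1 := by decide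

/-- `e₁ ≠ e₂` in `ℤ₅²`. [folklore] -/
theorem Z5Z5ThreeSet.e10_ne_e01 : ((1, 0) : ZMod 5 × ZMod 5) ≠ (0, 1) := by decide

/-- **Core theorem** (parts `3` and `d`, `d ∈ {3, 4}` via the finite statement `hfin` = `fin33` / `fin34`).  `|A| = 325`,
`Φ : A ↠ ℤ₅²`, `Ψ : A →+ ZMod 13` non-zero with vanishing `Φ`-fibre sums; a cube symmetric form with `|W| = 3`, `|X| = d`.  Then
`False`. [folklore] -/
theorem no_cube_form_3x_of_card325 (d : ℕ)
    (hfin : ∀ g : Fin (5 * 5) → ℕ, ∑ i, g i = d → ∀ σ : ℕ, σ < 25 →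
      (∃ j < 6, ∃ certs : List (ℕ × List ℕ),
        lineCert3At 5 (vecFn (wvec j)) (vecFn (cnts 5 j g)) certs ((pv 5 j σ : ℕ) : ZMod 5) = true) ∨
      ∃ e : List ℕ, (∀ i : Fin (5 * 5), g i = e.getD i.val 0) ∧ bridgeOK e = true ∧
        ((∃ c : ℕ × ℕ × List ℤ, c.1 < 25 ∧ refuteRowOK e σ c = true) ∨
         (σ = 12 ∧ ∃ h : List ℕ, ∃ rows : List (ℕ × List ℤ), ∃ L₁ L₂ : List ℕ,
            pinRowsOK e 12 h rows = true ∧ momentCertOK e h L₁ 1 0 = true ∧ momentCertOK e h L₂ 0 1 = true)))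
    (hA : Fintype.card A = 325) (Φ : A →+ ZMod 5 × ZMod 5) (hΦ : Function.Surjective Φ)
    (Ψ : A →+ ZMod 13) (hΨ : Ψ ≠ 0) (hΨΦ : ∀ t : ZMod 5 × ZMod 5, ∑ a ∈ univ.filter (fun a : A => Φ a = t), Ψ a = 0)
    {W X Y : Finset A} {x₀ : A} (hW : W.card = 3) (hX : X.card = d)
    (h₁ : Set.InjOn (fun p : A × A × A => -p.1 + p.2.1 + p.2.2) ↑(W ×ˢ X ×ˢ Y))
    (h₂ : Set.InjOn (fun p : A × A × A => p.1 - p.2.1 + p.2.2) ↑(W ×ˢ X ×ˢ Y))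
    (h₃ : Set.InjOn (fun p : A × A × A => p.1 + p.2.1 - p.2.2) ↑(W ×ˢ X ×ˢ Y))
    (d₁₂ : Disjoint ((W ×ˢ X ×ˢ Y).image fun p : A × A × A => -p.1 + p.2.1 + p.2.2)
      ((W ×ˢ X ×ˢ Y).image fun p : A × A × A => p.1 - p.2.1 + p.2.2))
    (d₁₃ : Disjoint ((W ×ˢ X ×ˢ Y).image fun p : A × A × A => -p.1 + p.2.1 + p.2.2)
      ((W ×ˢ X ×ˢ Y).image fun p : A × A × A => p.1 + p.2.1 - p.2.2))
    (d₂₃ : Disjoint ((W ×ˢ X ×ˢ Y).image fun p : A × A × A => p.1 - p.2.1 + p.2.2)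
      ((W ×ˢ X ×ˢ Y).image fun p : A × A × A => p.1 + p.2.1 - p.2.2))
    (hcover : ((W ×ˢ X ×ˢ Y).image fun p : A × A × A => -p.1 + p.2.1 + p.2.2) ∪
      ((W ×ˢ X ×ˢ Y).image fun p : A × A × A => p.1 - p.2.1 + p.2.2) ∪
      ((W ×ˢ X ×ˢ Y).image fun p : A × A × A => p.1 + p.2.1 - p.2.2) = univ.erase x₀) : False := by
  classical
  obtain ⟨w₀, w₁, w₂, h01, h02, h12, hWeq⟩ := card_eq_three.1 hW
  obtain ⟨t₁, t₂, t₃, e₁₂, e₁₃, e₂₃, tcov, cW, cX, -⟩ :=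
    cube_symmetric_form_translate h₁ h₂ h₃ d₁₂ d₁₃ d₂₃ hcover (-w₀)
  set W' := W.image (· + -w₀) with hW'
  set X' := X.image (· + -w₀) with hX'
  set Y' := Y.image (· + -w₀) with hY'
  set u := w₁ - w₀ with hu
  set v := w₂ - w₀ with hv
  have hWt : W' = {0, u, v} := by
    rw [hW', hWeq, image_insert, image_insert, image_singleton, add_neg_cancel, hu, hv, sub_eq_add_neg, sub_eq_add_neg]
  have hu0 : u ≠ 0 := sub_ne_zero.2 (Ne.symm h01)
  have hv0 : v ≠ 0 := sub_ne_zero.2 (Ne.symm h02)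
  have huv : u ≠ v := fun e => h12 (sub_left_injective e)
  -- `ker Ψ` is a proper subgroup
  have hKer : Ψ.ker ≠ ⊤ := by
    intro htop
    apply hΨ
    ext a
    have : a ∈ Ψ.ker := by rw [htop]; exact AddSubgroup.mem_top a
    simpa using this
  by_cases hD : (Φ u).1 * (Φ v).2 - (Φ u).2 * (Φ v).1 = 0
  · -- degenerate images: `W'` lies in the proper subgroup `ker (λ ∘ Φ)`
    obtain ⟨ab, hab, hau, hav⟩ := exists_form_of_det_eq_zero (Φ u) (Φ v) hD
    set ψ : A →+ ZMod 5 := (lmap ab.1 ab.2).comp Φ with hψ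
    have hψs : Function.Surjective ψ := (lmap_surjective ab hab).comp hΦ
    have hH : ψ.ker ≠ ⊤ := by
      intro htop
      obtain ⟨a, ha⟩ := hψs 1
      have hmem : a ∈ ψ.ker := by rw [htop]; exact AddSubgroup.mem_top a
      rw [AddMonoidHom.mem_ker] at hmem
      exact absurd (ha.symm.trans hmem) (by decide)
    have hcard := card_eq_one_of_subset_coset t₁ t₂ t₃ e₁₂ e₁₃ e₂₃ tcov ψ.ker hH 0 (fun w hw => by
      rw [sub_zero, AddMonoidHom.mem_ker]
      rw [hWt] at hw
      simp only [mem_insert, mem_singleton] at hw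
      rcases hw with rfl | rfl | rfl
      · exact map_zero ψ
      · show lmap ab.1 ab.2 (Φ u) = 0
        rw [lmap_apply]; exact hau
      · show lmap ab.1 ab.2 (Φ v) = 0
        rw [lmap_apply]; exact hav)
    rw [cW, hW] at hcard
    omega
  · -- a basis change puts `Φ(W') = {0, e₁, e₂}`
    haveI : Fact (Nat.Prime 5) := ⟨by norm_num⟩
    set E := basisEquiv (Φ u) (Φ v) hD with hE
    set Φ' : A →+ ZMod 5 × ZMod 5 := E.symm.toAddMonoidHom.comp Φ with hΦ'
    have hΦ's : Function.Surjective Φ' := E.symm.surjective.comp hΦ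
    have hΦ'u : Φ' u = (1, 0) := by
      show E.symm (Φ u) = _
      rw [AddEquiv.symm_apply_eq]; exact (basisEquiv_one_zero _ _ hD).symm
    have hΦ'v : Φ' v = (0, 1) := by
      show E.symm (Φ v) = _
      rw [AddEquiv.symm_apply_eq]; exact (basisEquiv_zero_one _ _ hD).symm
    have eΦ' : ∀ a, Φ' a = E.symm (Φ a) := fun a => rfl
    -- fibre sums of `Ψ` along `Φ'`
    have hΨΦ' : ∀ t : ZMod 5 × ZMod 5, ∑ a ∈ univ.filter (fun a : A => Φ' a = t), Ψ a = 0 := by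
      intro t
      have hset : (univ.filter fun a : A => Φ' a = t) = univ.filter fun a : A => Φ a = E t := by
        ext a
        simp only [mem_filter, mem_univ, true_and, eΦ']
        rw [AddEquiv.symm_apply_eq]
      rw [hset]; exact hΨΦ (E t)
    -- hole position and the image multiset of `X'`
    set s : ZMod 5 × ZMod 5 := Φ' (x₀ + -w₀) with hs
    set σ : ℕ := ptIdx 5 s with hσdef
    have hσ : σ < 25 := ptIdx_lt 5 s
    have hsσ : pt 5 σ = s := by rw [hσdef, pt_ptIdx]
    set g : Fin (5 * 5) → ℕ := fun i => (X'.filter fun a => Φ' a = pt 5 i.val).card with hg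
    have hgsum : ∑ i, g i = d := by
      have h0 := ZpZpDomino.sum_card_fibre_shift Φ' X' 0
      rw [sum_eq_sum_pt 5] at h0
      simp only [add_zero] at h0
      rw [cX, hX] at h0
      exact h0
    -- fibre counts of `W'`
    have hWc : ∀ t : ZMod 5 × ZMod 5, (W'.filter fun a => Φ' a = t).card =
        (if (0 : ZMod 5 × ZMod 5) = t then 1 else 0) + ((if ((1, 0) : ZMod 5 × ZMod 5) = t then 1 else 0) +
          (if ((0, 1) : ZMod 5 × ZMod 5) = t then 1 else 0)) := by
      intro t
      rw [hWt, card_filter, sum_insert (by simp [hu0.symm, hv0.symm]), sum_insert (by simpa using huv), sum_singleton,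
        map_zero, hΦ'u, hΦ'v]
    rcases hfin g hgsum σ hσ with ⟨j, hj, certs, hcert⟩ | ⟨e, hge, hb, hrest⟩
    · -- (a) a certified LINE direction: the line identity along `lineDir j ∘ Φ'`
      set π : ZMod 5 × ZMod 5 →+ ZMod 5 := lineDir 5 j with hπ
      set φ : A →+ ZMod 5 := π.comp Φ' with hφ
      have hφs : Function.Surjective φ := (lineDir_surjective 5 j).comp hΦ's
      have eφ : ∀ a, φ a = π (Φ' a) := fun a => rfl
      have hWl : ∀ t : ZMod 5, (W'.filter fun a => φ a = t).card = vecFn (wvec j) t := by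
        intro t
        rw [vecFn_wvec j hj t, hWt, card_filter, sum_insert (by simp [hu0.symm, hv0.symm]),
          sum_insert (by simpa using huv), sum_singleton, map_zero, eφ u, eφ v, hΦ'u, hΦ'v]
      have hXl : ∀ t : ZMod 5, (X'.filter fun a => φ a = t).card = vecFn (cnts 5 j g) t := by
        intro t
        show _ = (cnts 5 j g).getD t.val 0
        rw [getD_cnts j g (ZMod.val_lt t), ← sum_filter_eq_sum_pick 5 j (fun w => (X'.filter fun a => Φ' a = w).card)
          (ZMod.val_lt t), ZMod.natCast_zmod_val, ← card_fibre_comp_eq_sum Φ' π X' t]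
        simp only [eφ]
      have hhole : φ (x₀ + -w₀) = ((pv 5 j σ : ℕ) : ZMod 5) := by
        rw [eφ, ← hs, ← pt_ptIdx 5 s, ← hσdef, ← lineDir_pt_val 5 j σ, ZMod.natCast_zmod_val]
      refine lineCert3At_sound hcert (fun t => (Y'.filter fun a => φ a = t).card)
        (univ.filter fun a : A => φ a = 0).card (lineMat3_identity_of_double_sum fun t => ?_)
      have hid := ThreeSetNorm.three_set_line_identity φ hφs t₁ t₂ t₃ e₁₂ e₁₃ e₂₃ tcov t
      simp only [hWl, hXl, hhole] at hid
      exact hid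
    · -- (b) an explicit exception: the PLANE identity at fibre size `13`
      have hK : (univ.filter fun a : A => Φ' a = 0).card = 13 := by
        have h25 := twentyfive_mul_card_fibre Φ' hΦ's
        rw [hA] at h25
        omega
      have hXg : ∀ w : ZMod 5 × ZMod 5, (X'.filter fun a => Φ' a = w).card = gridFn e w := by
        intro w
        have h1 := hge ⟨ptIdx 5 w, ptIdx_lt 5 w⟩
        simp only [hg, pt_ptIdx] at h1
        exact h1
      have hWg : ∀ w : ZMod 5 × ZMod 5, (W'.filter fun a => Φ' a = w).card = gridFn tlist w := fun w => by
        rw [hWc, ite_T_eq_gridFn_tlist]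
      have hW00 : (W'.filter fun a => Φ' a = (0, 0)).card = 1 := by rw [hWg]; exact gridFn_tlist_vals.1
      have hW10 : (W'.filter fun a => Φ' a = (1, 0)).card = 1 := by rw [hWg]; exact gridFn_tlist_vals.2.1
      have hW01 : (W'.filter fun a => Φ' a = (0, 1)).card = 1 := by rw [hWg]; exact gridFn_tlist_vals.2.2
      have hW0 : ∀ w : ZMod 5 × ZMod 5, w ≠ (0, 0) → w ≠ (1, 0) → w ≠ (0, 1) →
          (W'.filter fun a => Φ' a = w).card = 0 := by
        intro w hw0 hw1 hw2
        have e0 : ¬ ((0 : ZMod 5 × ZMod 5) = w) := fun h' => hw0 h'.symm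
        have e1 : ¬ (((1, 0) : ZMod 5 × ZMod 5) = w) := fun h' => hw1 h'.symm
        have e2 : ¬ (((0, 1) : ZMod 5 × ZMod 5) = w) := fun h' => hw2 h'.symm
        rw [hWc, if_neg e0, if_neg e1, if_neg e2]
      have hplane : ∀ t : ZMod 5 × ZMod 5, (∑ w : ZMod 5 × ZMod 5, planeMat e t w * (Y'.filter fun a => Φ' a = w).card) +
          (if pt 5 σ = t then 1 else 0) = 13 := by
        intro t
        have hid := ThreeSetNorm.three_set_line_identity Φ' hΦ's t₁ t₂ t₃ e₁₂ e₁₃ e₂₃ tcov t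
        have hds := double_sum_eq_planeMat (fun w => (W'.filter fun a => Φ' a = w).card)
          (fun w => (X'.filter fun a => Φ' a = w).card) (fun w => (Y'.filter fun a => Φ' a = w).card) e hW00 hW10 hW01 hW0
          hXg t
        rw [hK, hds, ← hs, ← hsσ] at hid
        exact hid
      rcases hrest with ⟨c, hcu, hc⟩ | ⟨h12, h, rows, L₁, L₂, hpin, hm1, hm2⟩
      · -- (b1) a plane row certificate refutes the hole position
        exact false_of_refuteRowOK hb hσ hc hcu _ hplane
      · -- (b2) the rigid configuration: pin `Y`, then the `ℤ₁₃` moment stage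
        have hpin' : pinRowsOK e σ h rows = true := by rw [h12]; exact hpin
        have hYg : ∀ w : ZMod 5 × ZMod 5, (Y'.filter fun a => Φ' a = w).card = gridFn h w :=
          eq_of_pinRowsOK hb hσ hpin' _ hplane
        have hs22 : Φ' (x₀ + -w₀) = (2, 2) := by rw [← hs, ← hsσ, h12, pt_twelve]
        -- the collected fibre-moment identities
        have eW : fcnt Φ' W' = zc tlist := by funext w; unfold fcnt zc; rw [hWg w]
        have eX : fcnt Φ' X' = zc e := by funext w; unfold fcnt zc; rw [hXg w]
        have eY : fcnt Φ' Y' = zc h := by funext w; unfold fcnt zc; rw [hYg w]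
        have hmom : ∀ t : ZMod 5 × ZMod 5,
            (∑ w, fsum Φ' Ψ W' w * momA (zc e) (zc h) t w) + (∑ r, fsum Φ' Ψ X' r * momB (zc tlist) (zc h) t r) +
              (∑ w, fsum Φ' Ψ Y' w * momC (zc tlist) (zc e) t w) +
              (if ((2, 2) : ZMod 5 × ZMod 5) = t then Ψ (x₀ + -w₀) else 0) = 0 := by
          intro t
          have hid := fibre_moment_identity Φ' Ψ t₁ t₂ t₃ e₁₂ e₁₃ e₂₃ tcov t
          rw [fibre_moment_collected, hΨΦ' t, eW, eX, eY, hs22] at hid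
          exact hid
        -- supports of the unknown fibre sums
        have hWs : ∀ w : ZMod 5 × ZMod 5, fsum Φ' Ψ W' w =
            (if Φ' u = w then Ψ u else 0) + (if Φ' v = w then Ψ v else 0) := by
          intro w
          unfold fsum
          rw [sum_filter, hWt, sum_insert (by simp [hu0.symm, hv0.symm]), sum_insert (by simpa using huv), sum_singleton,
            map_zero, map_zero]
          simp
        have h10 : ((1, 0) : ZMod 5 × ZMod 5) ≠ (0, 1) := e10_ne_e01
        have hWu : fsum Φ' Ψ W' (1, 0) = Ψ u := by rw [hWs, hΦ'u, hΦ'v, if_pos rfl, if_neg h10.symm, add_zero]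
        have hWv : fsum Φ' Ψ W' (0, 1) = Ψ v := by rw [hWs, hΦ'u, hΦ'v, if_neg h10, if_pos rfl, zero_add]
        have hW0' : ∀ w : ZMod 5 × ZMod 5, w ≠ (1, 0) → w ≠ (0, 1) → fsum Φ' Ψ W' w = 0 := by
          intro w hw1 hw2
          rw [hWs, hΦ'u, hΦ'v, if_neg (Ne.symm hw1), if_neg (Ne.symm hw2), add_zero]
        have hX0 : ∀ r : ZMod 5 × ZMod 5, gridFn e r = 0 → fsum Φ' Ψ X' r = 0 := by
          intro r hr
          unfold fsum
          rw [← hXg r, card_eq_zero] at hr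
          rw [hr, sum_empty]
        have hY0 : ∀ w : ZMod 5 × ZMod 5, gridFn h w = 0 → fsum Φ' Ψ Y' w = 0 := by
          intro w hw
          unfold fsum
          rw [← hYg w, card_eq_zero] at hw
          rw [hw, sum_empty]
        have k1 := lin_comb_Ws_eq_zero hm1 _ _ _ _ hmom hW0' hX0 hY0
        have k2 := lin_comb_Ws_eq_zero hm2 _ _ _ _ hmom hW0' hX0 hY0
        rw [hWu, hWv, one_mul, zero_mul, add_zero] at k1
        rw [hWu, hWv, zero_mul, one_mul, zero_add] at k2
        -- `W' ⊆ ker Ψ`, a proper subgroup: `|W| = 1`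
        have hcard := card_eq_one_of_subset_coset t₁ t₂ t₃ e₁₂ e₁₃ e₂₃ tcov Ψ.ker hKer 0 (fun w hw => by
          rw [sub_zero, AddMonoidHom.mem_ker]
          rw [hWt] at hw
          simp only [mem_insert, mem_singleton] at hw
          rcases hw with rfl | rfl | rfl
          · exact map_zero Ψ
          · exact k1
          · exact k2)
        rw [cW, hW] at hcard
        omega

/-- **No three-set cube symmetric form with `|W| = 3`, `|X| = 3`** over `A` of order `325` with `Φ : A ↠ ℤ₅²` and a non-zero
`Ψ : A →+ ZMod 13` whose `Φ`-fibre sums vanish (e.g. `A = ℤ₅ × ℤ₆₅`). [folklore] -/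
theorem no_cube_form_33_of_card325 (hA : Fintype.card A = 325) (Φ : A →+ ZMod 5 × ZMod 5) (hΦ : Function.Surjective Φ)
    (Ψ : A →+ ZMod 13) (hΨ : Ψ ≠ 0) (hΨΦ : ∀ t : ZMod 5 × ZMod 5, ∑ a ∈ univ.filter (fun a : A => Φ a = t), Ψ a = 0)
    {W X Y : Finset A} {x₀ : A} (hW : W.card = 3) (hX : X.card = 3)
    (h₁ : Set.InjOn (fun p : A × A × A => -p.1 + p.2.1 + p.2.2) ↑(W ×ˢ X ×ˢ Y))
    (h₂ : Set.InjOn (fun p : A × A × A => p.1 - p.2.1 + p.2.2) ↑(W ×ˢ X ×ˢ Y))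
    (h₃ : Set.InjOn (fun p : A × A × A => p.1 + p.2.1 - p.2.2) ↑(W ×ˢ X ×ˢ Y))
    (d₁₂ : Disjoint ((W ×ˢ X ×ˢ Y).image fun p : A × A × A => -p.1 + p.2.1 + p.2.2)
      ((W ×ˢ X ×ˢ Y).image fun p : A × A × A => p.1 - p.2.1 + p.2.2))
    (d₁₃ : Disjoint ((W ×ˢ X ×ˢ Y).image fun p : A × A × A => -p.1 + p.2.1 + p.2.2)
      ((W ×ˢ X ×ˢ Y).image fun p : A × A × A => p.1 + p.2.1 - p.2.2))
    (d₂₃ : Disjoint ((W ×ˢ X ×ˢ Y).image fun p : A × A × A => p.1 - p.2.1 + p.2.2)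
      ((W ×ˢ X ×ˢ Y).image fun p : A × A × A => p.1 + p.2.1 - p.2.2))
    (hcover : ((W ×ˢ X ×ˢ Y).image fun p : A × A × A => -p.1 + p.2.1 + p.2.2) ∪
      ((W ×ˢ X ×ˢ Y).image fun p : A × A × A => p.1 - p.2.1 + p.2.2) ∪
      ((W ×ˢ X ×ˢ Y).image fun p : A × A × A => p.1 + p.2.1 - p.2.2) = univ.erase x₀) : False :=
  no_cube_form_3x_of_card325 3 fin33 hA Φ hΦ Ψ hΨ hΨΦ hW hX h₁ h₂ h₃ d₁₂ d₁₃ d₂₃ hcover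

/-- **No three-set cube symmetric form with `|W| = 3`, `|X| = 4`** over `A` of order `325` with `Φ : A ↠ ℤ₅²` and a non-zero
`Ψ : A →+ ZMod 13` whose `Φ`-fibre sums vanish (e.g. `A = ℤ₅ × ℤ₆₅`). [folklore] -/
theorem no_cube_form_34_of_card325 (hA : Fintype.card A = 325) (Φ : A →+ ZMod 5 × ZMod 5) (hΦ : Function.Surjective Φ)
    (Ψ : A →+ ZMod 13) (hΨ : Ψ ≠ 0) (hΨΦ : ∀ t : ZMod 5 × ZMod 5, ∑ a ∈ univ.filter (fun a : A => Φ a = t), Ψ a = 0)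
    {W X Y : Finset A} {x₀ : A} (hW : W.card = 3) (hX : X.card = 4)
    (h₁ : Set.InjOn (fun p : A × A × A => -p.1 + p.2.1 + p.2.2) ↑(W ×ˢ X ×ˢ Y))
    (h₂ : Set.InjOn (fun p : A × A × A => p.1 - p.2.1 + p.2.2) ↑(W ×ˢ X ×ˢ Y))
    (h₃ : Set.InjOn (fun p : A × A × A => p.1 + p.2.1 - p.2.2) ↑(W ×ˢ X ×ˢ Y))
    (d₁₂ : Disjoint ((W ×ˢ X ×ˢ Y).image fun p : A × A × A => -p.1 + p.2.1 + p.2.2)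
      ((W ×ˢ X ×ˢ Y).image fun p : A × A × A => p.1 - p.2.1 + p.2.2))
    (d₁₃ : Disjoint ((W ×ˢ X ×ˢ Y).image fun p : A × A × A => -p.1 + p.2.1 + p.2.2)
      ((W ×ˢ X ×ˢ Y).image fun p : A × A × A => p.1 + p.2.1 - p.2.2))
    (d₂₃ : Disjoint ((W ×ˢ X ×ˢ Y).image fun p : A × A × A => p.1 - p.2.1 + p.2.2)
      ((W ×ˢ X ×ˢ Y).image fun p : A × A × A => p.1 + p.2.1 - p.2.2))
    (hcover : ((W ×ˢ X ×ˢ Y).image fun p : A × A × A => -p.1 + p.2.1 + p.2.2) ∪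
      ((W ×ˢ X ×ˢ Y).image fun p : A × A × A => p.1 - p.2.1 + p.2.2) ∪
      ((W ×ˢ X ×ˢ Y).image fun p : A × A × A => p.1 + p.2.1 - p.2.2) = univ.erase x₀) : False :=
  no_cube_form_3x_of_card325 4 fin34 hA Φ hΦ Ψ hΨ hΨΦ hW hX h₁ h₂ h₃ d₁₂ d₁₃ d₂₃ hcover

end Core

end Summit.MatrixMultiplication.OmegaCensus
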